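import Summits.NavierStokesRegularity.NavierStokesRegularity.Theorems.TypeICertificateLadderRungReynoldsOneWeightedSlice
import HarnessLib

/-!
# Crux `Target` = `TypeICertificateLadder.NoTypeIBlowup` (stmt-NavierStokesRegularity-1217), line
# `depletion-ladder`, stub S2 `stub_rung_of_depletion`: the DEPLETED enstrophy slice inequality

`--supports stmt-NavierStokesRegularity-1217` (line `depletion-ladder`, skeleton
`Cruxes/Target/Lines/depletion_ladder.lean`, registered 2026-08-17, sha f7213e70…; stub S2
`stub_rung_of_depletion : ∀ κ > 0, StretchingDepletion κ → ∀ C > 0, κC < 1 → Rung C`).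

This file is the one-time (slice) input of S2. Under the line's **stretching-depletion hypothesis
with constant `κ`** — for every `C²` divergence-free `u` bounded by `M` with `ω = curl u`,
`ω, ∇ω ∈ L²` and integrable stretching density,
`|∫ ⟪ω, Du ω⟫| ≤ κ · M · ‖ω‖₂ · ‖∇ω‖₂` (the body of the line-local `StretchingDepletion κ`,
unfolded verbatim) — the vorticity equation `curl ∂ₜu = νΔω − (u·∇)ω + (ω·∇)u` gives at one time

  `∫ ⟪ω, curl ∂ₜu⟫ = −ν‖∇ω‖₂² − 0 + ∫⟪ω, Du ω⟫ ≤ −ν‖∇ω‖₂² + κM‖ω‖₂‖∇ω‖₂ ≤ (κ²M²/(4ν)) ‖ω‖₂²`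

(`depleted_enstrophy_slice`), i.e. `d/dt ‖ω‖₂² ≤ (κ²M²/(2ν)) ‖ω‖₂²`: the enstrophy Grönwall
exponent of rung one's `q = 2` bookkeeping (`Target.Negative.lintegral_frobeniusNormSq_le_exp_half_linfty`,
the case `κ = 1`) acquires the factor `κ²`. The two integrations by parts are the unweighted twins of
the tree's `RungReynoldsOne.weightedSlice_transport` / `weightedSlice_viscous`:

* `enstrophy_transport` — `∫ ⟪ω, (v·∇)ω⟫ = ∫ ⟪∇(½‖ω‖²), v⟫ = 0` for `div v = 0`
  (`integral_inner_gradient_eq_zero_of_isDivFree_R3`);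
* `enstrophy_viscous` — `∫ ⟪Δω, ω⟫ = −∫ |∇ω|²` (`integral_sum_inner_fderiv_fderiv_eq_neg_integral_inner_laplacian`).

WHAT THIS IS NOT: not a proof of any depletion constant (S1 `stub_depletionBelowHalf` is open); a
conditional one-time budget, the slice step of the conditional rung S2.

References: P. G. Lemarié-Rieusset, *The Navier–Stokes Problem in the 21st Century* (2016), §11.6
(vorticity equation) and Thm. 11.2 (enstrophy Grönwall under an `L^∞` bound); the computation is
elementary. [folklore]
-/

noncomputable section

open Set Filter Topology MeasureTheory
open scoped RealInnerProductSpace ENNReal NNReal Laplacian ContDiff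
open Literature.Analysis.FluidPDE

namespace Summit.NavierStokesRegularity.NavierStokesRegularity.Theorems.DepletionLadder

-- the problem directory repeats the summit name (`NavierStokesRegularity/NavierStokesRegularity`)
set_option linter.dupNamespace false

open Summit.NavierStokesRegularity.NavierStokesRegularity.Theorems.RungReynoldsOne
open Summit.NavierStokesRegularity.NavierStokesRegularity.Theorems.RungReynoldsOne.WeightedSlice

/-! ### The transport term -/

/-- **Transport term (unweighted).** For `v ∈ C¹(ℝ³; ℝ³)` divergence free, bounded with bounded
gradient, and `w ∈ C²(ℝ³; ℝ³)` with `w, ∂ᵢw ∈ L²`: the enstrophy transport density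
`⟪w, (v·∇)w⟫ = ⟪∇(½‖w‖²), v⟫` is integrable and `∫ ⟪w, (v·∇)w⟫ = 0`
(`integral_inner_gradient_eq_zero_of_isDivFree_R3`; unweighted twin of
`RungReynoldsOne.weightedSlice_transport`). [folklore] -/
theorem enstrophy_transport {v w : EuclideanSpace ℝ (Fin 3) → EuclideanSpace ℝ (Fin 3)}
    (hv : ContDiff ℝ 1 v) (hw : ContDiff ℝ 2 w) (hdiv : VectorCalculus.IsDivFree v) {M B : ℝ}
    (hM : ∀ x, ‖v x‖ ≤ M) (hB : ∀ x, ‖fderiv ℝ v x‖ ≤ B) (l2w : ∫⁻ x, ‖w x‖ₑ ^ 2 < ⊤)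
    (l2dw : ∀ i, ∫⁻ x, ‖fderiv ℝ w x (EuclideanSpace.basisFun (Fin 3) ℝ i)‖ₑ ^ 2 < ⊤) :
    Integrable (fun x => ⟪w x, fderiv ℝ w x (v x)⟫) volume ∧
    ∫ x, ⟪w x, fderiv ℝ w x (v x)⟫ = 0 := by
  set e := EuclideanSpace.basisFun (Fin 3) ℝ with he
  have he1 : ∀ i, ‖e i‖ = 1 := fun i => by simp [he]
  set F : EuclideanSpace ℝ (Fin 3) → ℝ := fun y => 2⁻¹ * ‖w y‖ ^ 2 with hF
  -- regularity and continuity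
  have hw1 : ContDiff ℝ 1 w := hw.of_le (by norm_num)
  have hdw : Differentiable ℝ w := hw1.differentiable one_ne_zero
  have hFs : ContDiff ℝ 1 F := contDiff_const.mul (hw1.norm_sq ℝ)
  have cv : Continuous v := hv.continuous
  have cw : Continuous w := hw.continuous
  have cF : Continuous F := hFs.continuous
  have cdw : ∀ i, Continuous fun x => fderiv ℝ w x (e i) := fun i =>
    (hw1.continuous_fderiv one_ne_zero).clm_apply continuous_const
  have cdv : ∀ i, Continuous fun x => fderiv ℝ v x (e i) := fun i =>
    (hv.continuous_fderiv one_ne_zero).clm_apply continuous_const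
  have cdF : ∀ i, Continuous fun x => fderiv ℝ F x (e i) := fun i =>
    (hFs.continuous_fderiv one_ne_zero).clm_apply continuous_const
  -- the derivative of the potential `F = ½‖w‖²`
  have hdF : ∀ x u, fderiv ℝ F x u = ⟪w x, fderiv ℝ w x u⟫ := by
    intro x u
    have hd : HasFDerivAt F ((2⁻¹ : ℝ) • ((2 : ℕ) • (innerSL ℝ (w x)).comp (fderiv ℝ w x))) x :=
      ((hdw x).hasFDerivAt.norm_sq).const_mul 2⁻¹
    rw [hd.fderiv]
    simp only [FunLike.coe_smul, Pi.smul_apply, ContinuousLinearMap.coe_comp,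
      Function.comp_apply, innerSL_apply_apply]
    rw [nsmul_eq_mul, smul_eq_mul]
    push_cast
    ring
  -- pointwise bounds
  have hei : ∀ i (y : EuclideanSpace ℝ (Fin 3)), ‖⟪e i, y⟫‖ ≤ ‖y‖ := fun i y =>
    (norm_inner_le_norm (𝕜 := ℝ) (e i) y).trans (by rw [he1, one_mul])
  have nF : ∀ x, ‖F x‖ ≤ 2⁻¹ * ‖w x‖ * ‖w x‖ := fun x => by
    rw [hF]
    simp only
    rw [Real.norm_of_nonneg (by positivity), sq, mul_assoc]
  have ndF : ∀ x i, ‖fderiv ℝ F x (e i)‖ ≤ 1 * ‖w x‖ * ‖fderiv ℝ w x (e i)‖ := fun x i => by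
    rw [hdF, one_mul]
    exact norm_inner_le_norm _ _
  -- integrability hypotheses of the divergence identity
  have h1 : ∀ i, Integrable (fun x => ⟪e i, v x⟫ * fderiv ℝ F x (e i)) volume := fun i => by
    refine integrable_of_norm_le_const_mul_mul M ((continuous_const.inner cv).mul (cdF i)) cw
      (cdw i) l2w (l2dw i) fun x => ?_
    rw [norm_mul]
    have ha : ‖⟪e i, v x⟫‖ ≤ M := (hei i (v x)).trans (hM x)
    have hM0 : 0 ≤ M := (norm_nonneg _).trans (hM x)
    calc ‖⟪e i, v x⟫‖ * ‖fderiv ℝ F x (e i)‖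
        ≤ M * (1 * ‖w x‖ * ‖fderiv ℝ w x (e i)‖) :=
          mul_le_mul ha (ndF x i) (norm_nonneg _) hM0
      _ = M * ‖w x‖ * ‖fderiv ℝ w x (e i)‖ := by ring
  have h2 : ∀ i, Integrable (fun x => ⟪e i, fderiv ℝ v x (e i)⟫ * F x) volume := fun i => by
    refine integrable_of_norm_le_const_mul_mul (B * 2⁻¹) ((continuous_const.inner (cdv i)).mul cF)
      cw cw l2w l2w fun x => ?_
    rw [norm_mul]
    have ha : ‖⟪e i, fderiv ℝ v x (e i)⟫‖ ≤ B :=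
      (hei i _).trans (((fderiv ℝ v x).le_opNorm (e i)).trans (by rw [he1, mul_one]; exact hB x))
    have hB0 : 0 ≤ B := (norm_nonneg _).trans (hB x)
    calc ‖⟪e i, fderiv ℝ v x (e i)⟫‖ * ‖F x‖ ≤ B * (2⁻¹ * ‖w x‖ * ‖w x‖) :=
          mul_le_mul ha (nF x) (norm_nonneg _) hB0
      _ = B * 2⁻¹ * ‖w x‖ * ‖w x‖ := by ring
  have h3 : ∀ i, Integrable (fun x => ⟪e i, v x⟫ * F x) volume := fun i => by
    refine integrable_of_norm_le_const_mul_mul (M * 2⁻¹) ((continuous_const.inner cv).mul cF)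
      cw cw l2w l2w fun x => ?_
    rw [norm_mul]
    have ha : ‖⟪e i, v x⟫‖ ≤ M := (hei i (v x)).trans (hM x)
    have hM0 : 0 ≤ M := (norm_nonneg _).trans (hM x)
    calc ‖⟪e i, v x⟫‖ * ‖F x‖ ≤ M * (2⁻¹ * ‖w x‖ * ‖w x‖) :=
          mul_le_mul ha (nF x) (norm_nonneg _) hM0
      _ = M * 2⁻¹ * ‖w x‖ * ‖w x‖ := by ring
  have hzero := integral_inner_gradient_eq_zero_of_isDivFree_R3 hFs hv hdiv h1 h2 h3
  -- the transport density is `⟪∇F, v⟫`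
  have hgrad : ∀ x, ⟪gradient F x, v x⟫ = ⟪w x, fderiv ℝ w x (v x)⟫ := fun x => by
    rw [gradient, InnerProductSpace.toDual_symm_apply, hdF]
  have igrad : Integrable (fun x => ⟪gradient F x, v x⟫) volume := by
    refine (integrable_finsetSum Finset.univ fun i _ => h1 i).congr
      (Eventually.of_forall fun x => ?_)
    exact (inner_gradient_eq_sum_basisFun F x (v x)).symm
  have hfun : (fun x => ⟪w x, fderiv ℝ w x (v x)⟫) = fun x => ⟪gradient F x, v x⟫ :=
    funext fun x => (hgrad x).symm
  rw [hfun]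
  exact ⟨igrad, hzero⟩

/-! ### The viscous term -/

/-- **Viscous term (unweighted).** For `w ∈ C²(ℝ³; ℝ³)` with `w, ∂ᵢw, ∂ᵢ∂ᵢw ∈ L²`:
`⟪Δw, w⟫` and `|∇w|²` are integrable and `∫ ⟪Δw, w⟫ = −∫ |∇w|²` (Green's identity
`integral_sum_inner_fderiv_fderiv_eq_neg_integral_inner_laplacian` with the test field `w` itself,
`Σᵢ ‖∂ᵢw‖² = |∇w|²`; unweighted twin of `RungReynoldsOne.weightedSlice_viscous`). [folklore] -/
theorem enstrophy_viscous {w : EuclideanSpace ℝ (Fin 3) → EuclideanSpace ℝ (Fin 3)}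
    (hw : ContDiff ℝ 2 w) (l2w : ∫⁻ x, ‖w x‖ₑ ^ 2 < ⊤)
    (l2dw : ∀ i, ∫⁻ x, ‖fderiv ℝ w x (EuclideanSpace.basisFun (Fin 3) ℝ i)‖ₑ ^ 2 < ⊤)
    (l2ddw : ∀ i, ∫⁻ x, ‖fderiv ℝ (fun y => fderiv ℝ w y (EuclideanSpace.basisFun (Fin 3) ℝ i)) x
      (EuclideanSpace.basisFun (Fin 3) ℝ i)‖ₑ ^ 2 < ⊤) :
    Integrable (fun x => ⟪(Δ w) x, w x⟫) volume ∧
    Integrable (fun x => frobeniusNormSq (fderiv ℝ w x)) volume ∧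
    ∫ x, ⟪(Δ w) x, w x⟫ = -∫ x, frobeniusNormSq (fderiv ℝ w x) := by
  set e := EuclideanSpace.basisFun (Fin 3) ℝ with he
  -- regularity and continuity
  have hw1 : ContDiff ℝ 1 w := hw.of_le (by norm_num)
  have cw : Continuous w := hw.continuous
  have cdw : ∀ i, Continuous fun x => fderiv ℝ w x (e i) := fun i =>
    (hw1.continuous_fderiv one_ne_zero).clm_apply continuous_const
  have cddw : ∀ i, Continuous fun x => fderiv ℝ (fun y => fderiv ℝ w y (e i)) x (e i) := fun i =>
    (((hw.fderiv_right (m := 1) le_rfl).clm_apply contDiff_const).continuous_fderiv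
      one_ne_zero).clm_apply continuous_const
  have hin : ∀ (a b : EuclideanSpace ℝ (Fin 3)), ‖⟪a, b⟫‖ ≤ 1 * ‖a‖ * ‖b‖ := fun a b => by
    rw [one_mul]; exact norm_inner_le_norm _ _
  -- integrability of the three pairings
  have i1 : ∀ i, Integrable (fun x => ⟪fderiv ℝ (fun y => fderiv ℝ w y (e i)) x (e i), w x⟫)
      volume := fun i =>
    integrable_of_norm_le_const_mul_mul 1 ((cddw i).inner cw) (cddw i) cw (l2ddw i) l2w
      fun x => hin _ _
  have i2 : ∀ i, Integrable (fun x => ⟪fderiv ℝ w x (e i), fderiv ℝ w x (e i)⟫) volume :=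
    fun i =>
    integrable_of_norm_le_const_mul_mul 1 ((cdw i).inner (cdw i)) (cdw i) (cdw i) (l2dw i) (l2dw i)
      fun x => hin _ _
  have i3 : ∀ i, Integrable (fun x => ⟪fderiv ℝ w x (e i), w x⟫) volume := fun i =>
    integrable_of_norm_le_const_mul_mul 1 ((cdw i).inner cw) (cdw i) cw (l2dw i) l2w
      fun x => hin _ _
  have hG := integral_sum_inner_fderiv_fderiv_eq_neg_integral_inner_laplacian hw hw1 i1 i2 i3
  have iLap : Integrable (fun x => ⟪(Δ w) x, w x⟫) volume := by
    refine (integrable_finsetSum Finset.univ fun i _ => i1 i).congr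
      (Eventually.of_forall fun x => ?_)
    dsimp only
    rw [laplacian_eq_sum_fderiv_fderiv e hw x, sum_inner]
  -- `Σᵢ ⟪∂ᵢw, ∂ᵢw⟫ = |∇w|²`
  have hsum : (fun x => ∑ i, ⟪fderiv ℝ w x (e i), fderiv ℝ w x (e i)⟫) =
      fun x => frobeniusNormSq (fderiv ℝ w x) := by
    funext x
    rw [frobeniusNormSq_eq_sum e]
    exact Finset.sum_congr rfl fun i _ => real_inner_self_eq_norm_sq _
  have iFrob : Integrable (fun x => frobeniusNormSq (fderiv ℝ w x)) volume := by
    rw [← hsum]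
    exact integrable_finsetSum Finset.univ fun i _ => i2 i
  refine ⟨iLap, iFrob, ?_⟩
  rw [← hsum, hG, neg_neg]

/-! ### The depleted slice inequality -/

/-- **The depleted enstrophy slice inequality.** Assume the stretching-depletion hypothesis with
constant `κ` (the body of the line-local `DepletionLadder.StretchingDepletion κ`, verbatim): for
every `C²` divergence-free `u` bounded by `M` with `curl u, ∇curl u ∈ L²` and integrable stretching
density, `|∫ ⟪curl u, Du (curl u)⟫| ≤ κ · M · ‖curl u‖₂ · ‖∇ curl u‖₂`. Let `v` be smooth and
divergence free with `ω = curl v`, `|v| ≤ M`, `‖Dv‖ ≤ B`, `Dv, D²v, D³v ∈ L²`, and let `W`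
satisfy the vorticity equation `curl W = νΔω − (v·∇)ω + (ω·∇)v` (`W = ∂ₜu`, `v = u(t)` for a
classical solution, tree `IsClassicalNSSolutionOn.curl_timeDerivWithin_eq`). Then
`∫ ⟪ω, curl W⟫ ≤ (κ²M²/(4ν)) ∫ ‖ω‖²`: viscosity `−ν∫|∇ω|²` (`enstrophy_viscous`), transport `0`
(`enstrophy_transport`), stretching `≤ κM‖ω‖₂‖∇ω‖₂` (the hypothesis), and Young
`−νa² + κMza ≤ κ²M²z²/(4ν)`. [folklore] -/
theorem depleted_enstrophy_slice {ν κ : ℝ} (hν : 0 < ν)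
    (hdep : ∀ (u : EuclideanSpace ℝ (Fin 3) → EuclideanSpace ℝ (Fin 3)) (M : ℝ), ContDiff ℝ 2 u →
      VectorCalculus.IsDivFree u → (∀ x, ‖u x‖ ≤ M) →
      Integrable (fun x => ‖curl u x‖ ^ 2) →
      Integrable (fun x => frobeniusNormSq (fderiv ℝ (curl u) x)) →
      Integrable (fun x => ⟪curl u x, fderiv ℝ u x (curl u x)⟫) →
      |∫ x, ⟪curl u x, fderiv ℝ u x (curl u x)⟫| ≤
        κ * M * Real.sqrt (∫ x, ‖curl u x‖ ^ 2) *
          Real.sqrt (∫ x, frobeniusNormSq (fderiv ℝ (curl u) x)))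
    {v W : EuclideanSpace ℝ (Fin 3) → EuclideanSpace ℝ (Fin 3)} (hv : ContDiff ℝ ∞ v)
    (hdiv : VectorCalculus.IsDivFree v)
    (hcurl : ∀ x, curl W x = ν • (Δ (curl v)) x - convect v (curl v) x + convect (curl v) v x)
    {M B : ℝ} (hM : ∀ x, ‖v x‖ ≤ M) (hB : ∀ x, ‖fderiv ℝ v x‖ ≤ B)
    (h1 : ∫⁻ x, ‖iteratedFDeriv ℝ 1 v x‖ₑ ^ 2 < ⊤) (h2 : ∫⁻ x, ‖iteratedFDeriv ℝ 2 v x‖ₑ ^ 2 < ⊤)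
    (h3 : ∫⁻ x, ‖iteratedFDeriv ℝ 3 v x‖ₑ ^ 2 < ⊤) :
    ∫ x, ⟪curl v x, curl W x⟫ ≤ κ ^ 2 * M ^ 2 / (4 * ν) * ∫ x, ‖curl v x‖ ^ 2 := by
  set e := EuclideanSpace.basisFun (Fin 3) ℝ with he
  have he1 : ∀ i, ‖e i‖ = 1 := fun i => by simp [he]
  -- smoothness of the vorticity
  have hDv : ContDiff ℝ ∞ (fderiv ℝ v) := (contDiff_infty_iff_fderiv.1 hv).2
  have hω : ContDiff ℝ ∞ (curl v) := by
    rw [curl_eq_curlCLM_comp]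
    exact curlCLM.contDiff.comp hDv
  have hω2 : ContDiff ℝ 2 (curl v) := hω.of_le (by norm_cast)
  have hω1 : ContDiff ℝ 1 (curl v) := hω.of_le (by norm_cast)
  have hv1 : ContDiff ℝ 1 v := hv.of_le (by norm_cast)
  have hv2 : ContDiff ℝ 2 v := hv.of_le (by norm_cast)
  have cv : Continuous v := hv.continuous
  have cω : Continuous (curl v) := hω.continuous
  -- the vorticity equation with `convect` unfolded
  have hZ : ∀ x, curl W x =
      ν • (Δ (curl v)) x - fderiv ℝ (curl v) x (v x) + fderiv ℝ v x (curl v x) := hcurl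
  -- `ω, ∂ᵢω, ∂ᵢ∂ᵢω ∈ L²`
  have l2ω : ∫⁻ x, ‖curl v x‖ₑ ^ 2 < ⊤ := by
    refine lintegral_enorm_sq_lt_top_of_norm_le_const_mul ‖curlCLM‖ (fun x => ?_) h1
    rw [← norm_iteratedFDeriv_fderiv, norm_iteratedFDeriv_zero]
    exact norm_curl_le v x
  have l2dω : ∀ i, ∫⁻ x, ‖fderiv ℝ (curl v) x (e i)‖ₑ ^ 2 < ⊤ := fun i => by
    refine lintegral_enorm_sq_lt_top_of_norm_le_const_mul ‖curlCLM‖ (fun x => ?_) h2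
    calc ‖fderiv ℝ (curl v) x (e i)‖ ≤ ‖fderiv ℝ (curl v) x‖ := by
          simpa [he1] using (fderiv ℝ (curl v) x).le_opNorm (e i)
      _ ≤ ‖curlCLM‖ * ‖iteratedFDeriv ℝ 2 v x‖ := norm_fderiv_curl_le hv2 x
  have l2ddω : ∀ i, ∫⁻ x, ‖fderiv ℝ (fun y => fderiv ℝ (curl v) y (e i)) x (e i)‖ₑ ^ 2 < ⊤ :=
      fun i => by
    refine lintegral_enorm_sq_lt_top_of_norm_le_const_mul ‖curlCLM‖ (fun x => ?_) h3
    calc ‖fderiv ℝ (fun y => fderiv ℝ (curl v) y (e i)) x (e i)‖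
        ≤ ‖iteratedFDeriv ℝ 2 (curl v) x‖ := norm_fderiv_fderiv_apply_basisFun_le hω2 x i
      _ ≤ ‖curlCLM‖ * ‖iteratedFDeriv ℝ 3 v x‖ := by
          rw [curl_eq_curlCLM_comp, curlCLM.iteratedFDeriv_comp_left (hDv.contDiffAt (x := x))
            (i := 2) (by norm_cast), ← norm_iteratedFDeriv_fderiv]
          exact ContinuousLinearMap.norm_compContinuousMultilinearMap_le _ _
  -- the three terms
  obtain ⟨iLap, iFrob, hVisc⟩ := enstrophy_viscous hω2 l2ω l2dω l2ddω
  obtain ⟨iTr, hTr⟩ := enstrophy_transport hv1 hω2 hdiv hM hB l2ω l2dω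
  have iStr : Integrable (fun x => ⟪curl v x, fderiv ℝ v x (curl v x)⟫) volume := by
    refine integrable_of_norm_le_const_mul_mul B
      (cω.inner ((hv1.continuous_fderiv one_ne_zero).clm_apply cω)) cω cω l2ω l2ω fun x => ?_
    calc ‖⟪curl v x, fderiv ℝ v x (curl v x)⟫‖ ≤ ‖curl v x‖ * ‖fderiv ℝ v x (curl v x)‖ :=
          norm_inner_le_norm _ _
      _ ≤ ‖curl v x‖ * (B * ‖curl v x‖) :=
          mul_le_mul_of_nonneg_left ((fderiv ℝ v x).le_of_opNorm_le (hB x) _) (norm_nonneg _)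
      _ = B * ‖curl v x‖ * ‖curl v x‖ := by ring
  have isq : Integrable (fun x => ‖curl v x‖ ^ 2) volume :=
    integrable_sq_norm_of_lintegral_lt_top cω l2ω
  -- the depletion hypothesis at this slice
  have hJ := hdep v M hv2 hdiv hM isq iFrob iStr
  set Z : ℝ := ∫ x, ‖curl v x‖ ^ 2 with hZdef
  set A : ℝ := ∫ x, frobeniusNormSq (fderiv ℝ (curl v) x) with hAdef
  set J : ℝ := ∫ x, ⟪curl v x, fderiv ℝ v x (curl v x)⟫ with hJdef
  have hZ0 : 0 ≤ Z := integral_nonneg fun x => sq_nonneg _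
  have hA0 : 0 ≤ A := integral_nonneg fun x => frobeniusNormSq_nonneg _
  -- pointwise decomposition of the integrand
  have hfun : (fun x => ⟪curl v x, curl W x⟫) = fun x =>
      ν * ⟪(Δ (curl v)) x, curl v x⟫ - ⟪curl v x, fderiv ℝ (curl v) x (v x)⟫ +
        ⟪curl v x, fderiv ℝ v x (curl v x)⟫ := by
    funext x
    have hc : ⟪curl v x, ν • (Δ (curl v)) x⟫ = ν * ⟪(Δ (curl v)) x, curl v x⟫ := by
      rw [real_inner_smul_right, real_inner_comm]
    rw [hZ x, inner_add_right, inner_sub_right, hc]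
  have iAB : Integrable (fun x => ν * ⟪(Δ (curl v)) x, curl v x⟫ -
      ⟪curl v x, fderiv ℝ (curl v) x (v x)⟫) volume := (iLap.const_mul ν).sub iTr
  rw [hfun, integral_add iAB iStr, integral_sub (iLap.const_mul ν) iTr, integral_const_mul, hVisc,
    hTr, sub_zero]
  -- Young: `−νA + J ≤ −νA + κ M √Z √A ≤ κ²M² Z/(4ν)`
  have hJle : J ≤ κ * M * Real.sqrt Z * Real.sqrt A := (le_abs_self J).trans hJ
  set z : ℝ := Real.sqrt Z with hzdef
  set a : ℝ := Real.sqrt A with hadef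
  have hz2 : z ^ 2 = Z := Real.sq_sqrt hZ0
  have ha2 : a ^ 2 = A := Real.sq_sqrt hA0
  have hν4 : 0 < 4 * ν := by positivity
  have key : ν * -A + κ * M * z * a ≤ κ ^ 2 * M ^ 2 / (4 * ν) * Z := by
    rw [← hz2, ← ha2, div_mul_eq_mul_div, le_div_iff₀ hν4]
    nlinarith [sq_nonneg (κ * M * z - 2 * ν * a), hν]
  show ν * -A + J ≤ κ ^ 2 * M ^ 2 / (4 * ν) * Z
  linarith

end Summit.NavierStokesRegularity.NavierStokesRegularity.Theorems.DepletionLadder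

end
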